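import Summits.BirchSwinnertonDyer.Rank1Residual.X11b.BDPRouteOpenInputOdd
import Summits.BirchSwinnertonDyer.Rank1Residual.X11b.BDPRouteOpenInputTight
import Summits.BirchSwinnertonDyer.Rank1Residual.Partition.CornersSemistableX11b
import HarnessLib

/-!
# X11b at `p = 3` (team N8/O2, sub-target T3-TIGHT): THE open input at an ODD prime is TIGHT — on
# the Locus it is EQUIVALENT to `BSD(E,p)` given the published control identity, `p = 3` included
# (cell `b2b-bsdres`, team `x11b3`, seat p7, gen 1; companion `Three/OpenInputInstances.lean`)

HONEST FRAMING (verbatim, cell `b2b-bsdres`, run/shared/lean/b2b/bsd-rank1-residual/): the goal of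
the cell is to DELETE the COMBINATION-SHAPED residual classes for ALL analytic-rank `≤ 1` curves
over `ℚ` — "full BSD formula for every rank `≤ 1` curve in class `C`" assembled STRICTLY from
published theorems — so that the rank-`≤ 1` remainder becomes exactly the CONSTRUCTION-SHAPED
classes, which are TYPED (missing-input Props), NOT attempted; this is not "finishing BSD".
Research route (team N8/O2: STEP L at `3 ‖ N`); no claim beyond the stated class and loci; nothing
booked; X11b stays CONSTRUCTION-SHAPED and X11b@3 stays OPEN (RESIDUAL-MAP §I O2). THEOREMS ONLY;
no definition; no named fact; no `sorry`.

## What this file does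
The sibling `BDPRouteOpenInputTight.lean` (multr1-p2 gen 18) proves, for `p ≥ 5`, that on the Locus
(`(E,p) ∈` X11b, a (ram) prime, `p ∤ ∏_ℓ c_ℓ(E)`) THE open input of route p2
(`P2OpenInputOnTreeAt W p` = the anticyclotomic IMC lower bound at `𝟙` composed with the BDP formula
at `p ∣ N`, read on the tree's constructed `X_ac(E[p^∞])`) holds IF AND ONLY IF `BSD(E,p)` holds,
given the published facts of the route and the PUB-shaped control identity. Its `5 ≤ p` came from two
places only: the antecedent `5 ≤ p →` inside the gen-11 predicates, and the Tamagawa bookkeeping at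
the Heegner field. Both are gone since gen 18: the odd-prime predicate `P2OpenInputOnTreeOddAt`
(`BDPRouteOpenInputOdd.lean`) has no antecedent, and `TamagawaHeegnerExact.lean` proves
`∏_w c_w(E/K) = (∏_ℓ c_ℓ(E))²` prime-free. This file assembles the consequence at EVERY ODD PRIME,
`p = 3` INCLUDED — the prime of team N8/O2:

* §1 (datum, ANY prime) `imcLowerWaldspurgerOnTreeAt_of_controlOnTreeAt_of_indexLowerBoundAt_prime`:
  at a classical Heegner field, STEP L `IndexLowerBoundAt W p K P` ∧ (CTL)ᵗ ⟹ (IMC≥∘BDP)ᵗ; with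
  multr1-p2's forward direction, given (CTL)ᵗ: (IMC≥∘BDP)ᵗ ⟺ STEP L (`…_iff_…_prime`).
* §2 (pair, any ODD `p`) `P2.bsdp_of_locus_endState_odd` (Locus end state with the odd named input:
  published facts + THE open input AT THE PAIR, nothing else typed), `P2.openInputOnTreeOddAt_of_bsdp_of_ram`
  (`BSD(E,p)` ∧ the control identity ∧ (ram) ⟹ the open input), and
  **`P2.openInputOnTreeOddAt_iff_bsdp_of_locus`**: on the Locus, given the twelve published facts and
  the PUB-shaped control identity (stated INLINE, verbatim the body of `P2ControlOnTreeAt` minus its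
  antecedent `5 ≤ p`), `P2OpenInputOnTreeOddAt W p ↔ BSDp W p`.
* §3 (the `p = 3` rows) `P2.openInputOnTreeOddAt_three_iff_bsdp_of_locus` (X11b@3 ∧ (ram) ∧
  `3 ∤ ∏ c_ℓ` = census3's atom A1: 248 943 class-pairs `N < 5·10⁵`) and
  `P2.openInputOnTreeOddAt_three_iff_bsdp_of_semistable_of_not_dvd` (the semistable part, 100 315
  class-pairs, where (ram) is AUTOMATIC — `ram_of_semistable_of_irr_of_le_seven`, rmap-3 g4).
The companion `Three/OpenInputInstances.lean` draws the class-level reading ("STEP L at 3 on the Locus"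
is worth EXACTLY "`BSD(E,3)` on the Locus") and the per-pair INSTANCES (every pair certified at `3` by
an exact `3`-Selmer certificate or by Miller satisfies the open input, given the control identity).

## The control identity at `p = 3` — a LABELLED HYPOTHESIS, not a fact
The binder `hC` of §2–§3 is the PUB SHAPE of Castella, Camb. J. Math. 6 (2018) Thm. 2.3 read on the
tree's objects (`ControlOnTreeAt`, `X11b/AnticyclotomicLogLinks.lean`), quantified over the route's
data exactly as in `P2ControlOnTreeAt` (`X11b/BDPRouteRecord.lean`) with the antecedent `5 ≤ p`
removed. In print: Castella's Thm. 2.3 [`paper:arxiv-1704.06608` p0005 L93–L110: "assume that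
rank_ℤ(E(K)) = 1 and that #Ш(E/K)[p^∞] < ∞. Then X_ac^Σ(E[p^∞]) is Λ-torsion, and …
#ℤ_p/f_ac^Σ(0) = #Ш(E/K)[p^∞]·(#ℤ_p/((1 − a_p p⁻¹ + ε_p) log_{ω_E} P)/[E(K)⊗ℤ_p : ℤ_p.P])² ×
∏_{w∣N⁺, w∉Σ} c_w^{(p)}(E/K)·…, where ε_p = p⁻¹ if p ∤ N and ε_p = 0 otherwise"] stands under the
paper's §2.1 standing hypotheses [p0005 L4: "Let E/ℚ be a semistable elliptic curve of conductor N,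
and let p ⩾ 5 be a prime such that … ρ̄_{E,p} … is irreducible"]; its proof [p0005 L112: "this
follows easily from the 'Anticyclotomic Control Theorem' established in [JSW]"] is Jetchev–Skinner–Wan,
Camb. J. Math. 5 (2017) Thm. 3.3.1 [`paper:arxiv-1512.06894` p0011 L31 "Theorem 8 (Anticyclotomic
Control Theorem)"], printed under [p0006 L9: "Throughout, let p ≥ 3 be a fixed prime"] and the
assumptions (sst) [p0010: "V is semistable as a representation of G_{K_w} for all w ∣ p"], (HT),
(irred_K), (corank 1), (sur) of its §3.1, plus Castella's local computation (calcul). So AT `p = 3` the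
identity is NOT printed verbatim (Castella's standing `p ⩾ 5`), while its ingredients are printed for
`p ≥ 3`; in the tree its `≤` half is a THEOREM at every prime (`controlUpperOnTreeAt_datum_of_facts`,
multr1-p2 gen 17/19) and its `≥` half is route R1's atom (P11) (multr1-p1), NOT in the tree. LABEL of
`hC`: Castella2018 Thm. 2.3 SHAPE with "p ⩾ 5" read as "p odd" — open in the tree (≥ half),
hypothesis only, nothing asserted. It is used ONLY in the direction `BSD ⟹ open input`; the
direction `open input ⟹ BSD` uses no control hypothesis at all.

What this is NOT: it does not prove the open input at any pair (that would be `BSD(E,3)`); it does not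
touch labels or marks; the census X11b-1 relation is not used; (IMC≥∘BDP)ᵗ at `3 ‖ N` stays THE open
input of the team, with no source and no announcement (Howard 2007 "p ∤ 6N", Castella 2018/2020,
Skinner–Zhang 2014, Fouquet–Wan 2021 all at primes at least five). Hypothesis-echo note (team
REFEREE.md F2): every occurrence of a prime threshold in this file is PROSE recording a printed
hypothesis or a removed antecedent; no binder of any theorem below carries one. CONDITIONAL; nothing
booked.

References: [Castella2018] Thm. 2.3 (arXiv:1704.06608 p. 5), Thm. 3.2 (p. 9), (1.1); [Castella2018Erratum]
(2.4); [JetchevSkinnerWan2017] Thm. 3.3.1, §7.4.1 (eq:shalowerK-1), §7.3.1 (eq:tamK);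
[Skinner2016PacificMC] Thm. C and footnote 1; [Wuthrich2014] Prop. 21; [McCallumLMS1991] §1;
[Miller2011LMS] Def. 1.1; team files `cells/x11b3/REFEREE.md` (H-table), `cells/x11b3/OWNERS.md` T3-TIGHT.
-/

noncomputable section

open scoped Classical

open WeierstrassCurve NumberField IsDedekindDomain Field
open Literature.NumberTheory.EllipticCurves Literature.NumberTheory.EllipticCurves.GreenbergSelmer
  Literature.NumberTheory.EllipticCurves.ModularForms
  Literature.NumberTheory.EllipticCurves.Rank1Residual
  Literature.NumberTheory.EllipticCurves.Rank1Residual.Typed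
  Literature.NumberTheory.EllipticCurves.Wuthrich2014
  Literature.NumberTheory.EllipticCurves.BalakrishnanEtAl2019
  Literature.NumberTheory.QuadraticFields.Quadratic
  Literature.NumberTheory.Automorphic
  Literature.NumberTheory.GaloisRepresentations Literature.NumberTheory.GaloisCohomology
  Summit.BirchSwinnertonDyer.Rank1Residual.X11b.AcSelmer
  Summit.BirchSwinnertonDyer.Rank1Residual.X11b.LocBridge

namespace Summit.BirchSwinnertonDyer.Rank1Residual.X11b

/-! ### §1. At a datum, ANY prime: given the control identity, (IMC≥∘BDP)ᵗ ⟺ STEP L -/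

section Datum

variable {W : WeierstrassCurve ℚ} [W.IsElliptic] [W.IsGloballyMinimal] {K : Type} [Field K]
  [NumberField K] {p : ℕ} [Fact p.Prime] {κ : ZpExtension K p} {𝔭 : HeightOneSpectrum (𝓞 K)}
  {γ : Field.absoluteGaloisGroup K} [Fact (κ.IsTopGenerator γ)] {ι : K →+* ℚ_[p]}

/-- **STEP L ∧ (CTL)ᵗ ⟹ (IMC≥∘BDP)ᵗ at a classical Heegner field, ANY prime `p`** — the sibling's
`imcLowerWaldspurgerOnTreeAt_of_controlOnTreeAt_of_indexLowerBoundAt` with its `5 ≤ p` removed. For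
`K` imaginary quadratic with every `ℓ ∣ N_E` split and `Ш(E/K)` finite: the control identity gives a
generator `f_ac` of `Ch_Λ(X_ac)` with `ord_p f_ac(0) = ord_p #Ш(E/K)[p^∞] + 2((ord_p log_ω P − 1) −
ord_p[E(K):ℤP]) + ord_p ∏_{w∣N⁺} c_w(E/K)`; the Tamagawa terms are `2·ord_p ∏_ℓ c_ℓ(E)` for EVERY
prime (`padicValNat_tamagawaProductSplit_eq_of_heegner_prime`,
`padicValNat_tamagawaProduct_baseChange_of_heegner_prime` — the exact (eq:tamK) of
`TamagawaHeegnerExact.lean`); so STEP L `2·ord_p[E(K):ℤP] ≤ ord_p #Ш(E/K) + 2·ord_p ∏_ℓ c_ℓ(E)` is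
exactly `2·(ord_p log_ω P − 1) ≤ ord_p f_ac(0)`. Bookkeeping on PUB shapes; nothing asserted about
the links. [cite: Castella2018, Thm. 2.3 (arXiv:1704.06608 p. 5) and (1.1) (p. 2)]
[cite: JetchevSkinnerWan2017, §7.4.1 (eq:shalowerK-1) and §7.3.1 (eq:tamK) (arXiv:1512.06894 p. 30)] -/
theorem imcLowerWaldspurgerOnTreeAt_of_controlOnTreeAt_of_indexLowerBoundAt_prime
    (hK : IsImaginaryQuadratic K) {N : ℕ} (hN : W.conductorNorm ℤ = N)
    (hH : SatisfiesHeegnerHypothesis N K) {P : (W.baseChange K).toAffine.Point}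
    [Finite (W.baseChange K).sha]
    (hCTL : ControlOnTreeAt p κ 𝔭 γ ι P) (hL : IndexLowerBoundAt W p K P) :
    IMCLowerWaldspurgerOnTreeAt p κ 𝔭 γ ι P := by
  haveI : Finite (AddCommGroup.primaryComponent (W.baseChange K).sha p) :=
    Finite.of_injective _ Subtype.val_injective
  obtain ⟨n, hn, hne⟩ := hCTL
  refine ⟨n, hn, ?_⟩
  rw [padicValNat_tamagawaProductSplit_eq_of_heegner_prime W K p hN hH,
    padicValNat_tamagawaProduct_baseChange_of_heegner_prime W K p hK hN hH,
    padicValNat_card_addPrimaryComponent] at hne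
  unfold IndexLowerBoundAt at hL
  rw [WeierstrassCurve.shaOrder] at hL
  omega

/-- **Given the control identity at a classical Heegner field, (IMC≥∘BDP)ᵗ ⟺ STEP L — ANY prime.**
Forward: multr1-p2's `indexLowerBoundAt_of_onTreeUpperLinks_of_heegner_prime` (only the `≤` half of
control is used there); backward: the previous theorem.
[cite: Castella2018, Thm. 2.3 (p. 5), (1.1) (p. 2)] [cite: JetchevSkinnerWan2017, §7.4.1 (eq:shalowerK-1) (p. 30)] -/
theorem imcLowerWaldspurgerOnTreeAt_iff_indexLowerBoundAt_of_controlOnTreeAt_prime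
    (hK : IsImaginaryQuadratic K) {N : ℕ} (hN : W.conductorNorm ℤ = N)
    (hH : SatisfiesHeegnerHypothesis N K) {P : (W.baseChange K).toAffine.Point}
    [Finite (W.baseChange K).sha] (hCTL : ControlOnTreeAt p κ 𝔭 γ ι P) :
    IMCLowerWaldspurgerOnTreeAt p κ 𝔭 γ ι P ↔ IndexLowerBoundAt W p K P :=
  ⟨fun hIW ↦ indexLowerBoundAt_of_onTreeUpperLinks_of_heegner_prime hK hN hH hIW
      (controlUpperOnTreeAt_of_controlOnTreeAt hCTL),
    imcLowerWaldspurgerOnTreeAt_of_controlOnTreeAt_of_indexLowerBoundAt_prime hK hN hH hCTL⟩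

end Datum

/-! ### §2. Pair level, ANY ODD prime: on the Locus THE open input is EQUIVALENT to `BSD(E,p)` -/

section Pair

variable (W : WeierstrassCurve ℚ) [W.IsElliptic] [W.IsGloballyMinimal] (p : ℕ) [Fact p.Prime]

/-- **A1 — the Locus at ANY ODD prime (`(ram) ∧ p ∤ ∏_ℓ c_ℓ(E)`): `BSD(E,p)` from published facts and
THE open input `P2OpenInputOnTreeOddAt W p` AT THE PAIR — NOTHING ELSE TYPED.** The sibling's
`P2.bsdp_of_locus_endState` with `5 ≤ p` removed: lower half `P2.missingLowerBoundAt_of_openInputOddAt`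
(`Surj` from (ram), `surj_of_irr_of_ram`), upper half the THEOREM
`missingUpperBoundAt_of_classX11b_of_ram_of_not_dvd` (Kolyvagin 1990 + Gross–Zagier at a classical
Heegner field + Skinner 2016 Thm. C for the twist, printed for `p ≥ 3`; no Tamagawa defect as
`p ∤ ∏c`). Published binders: Gross–Zagier, Kolyvagin ×2, Skinner 2016 Thm. C, Wuthrich 2014 Prop. 21,
GZK, modularity ×2, Hoffstein–Luo, Mazur 1978 Cor. 4.1, Poitou–Tate, local Euler characteristic
(twelve; Néron scaling is a theorem). At `p = 3` the open input has no source and no announcement.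
CONDITIONAL; nothing booked. [cite: McCallumLMS1991, §1 Theorem (Kolyvagin), p. 296]
[cite: Skinner2016PacificMC, Thm. C (§1) and footnote 1] [cite: JetchevSkinnerWan2017, §7.4.1–7.4.3 (pp. 30–31)]
[cite: Castella2018, Thm. 2.3 (p. 5), Thm. 3.2 (p. 9)] [cite: Wuthrich2014, Prop. 21 (p. 400)] [cite: Miller2011LMS, Def. 1.1] -/
theorem P2.bsdp_of_locus_endState_odd
    (hGZ : ∀ (N : ℕ) [NeZero N] (W : WeierstrassCurve ℚ) (K : Type) [Field K] [NumberField K],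
      gross_zagier N W K)
    (hKo : ∀ (N : ℕ) [NeZero N] (W : WeierstrassCurve ℚ) (K : Type) [Field K] [NumberField K],
      kolyvagin N W K)
    (hB : ∀ (N : ℕ) [NeZero N] (W : WeierstrassCurve ℚ) (K : Type) [Field K] [NumberField K],
      Kolyvagin1990_padicValNat_card_sha_le N W K)
    (hSk : Skinner2016.thmC_padicValRat_bsd_rank_zero) (hWu : sha_dvd_analyticSha)
    (hGZK : rank_eq_analyticRank_of_analyticRank_le_one) (hmod : hasEntireLFunction_rat)
    (hnf : exists_isNewformOf) (hHL : HoffsteinLuo1997_exists_twist_L_one_ne_zero)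
    (hMaz : mazur_not_dvd_maninConstant_of_odd)
    (hPT : ∀ (K : Type) [Field K] [NumberField K], poitouTate_sum_localTatePairing_eq_zero K)
    (hEP : ∀ (K : Type) [Field K] [NumberField K] (v : HeightOneSpectrum (𝓞 K)),
      localEulerPoincareCharacteristic (v.adicCompletion K))
    -- THE open input (odd form), at this pair
    (hA : P2OpenInputOnTreeOddAt W p)
    -- the pair: X11b (so `p` odd), on the Locus
    (hX : ClassX11b W p) (hram : Ram W p) (htam : ¬ p ∣ W.tamagawaProduct) : BSDp W p := by
  have hsurj : Surj W p := surj_of_irr_of_ram W p hX.2.2.2 hram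
  refine Typed.bsdp_of_missingPPartAt W p hGZK (by rw [hX.1]) ?_
  exact Typed.missingPPartAt_of_lower_of_upper W p
    (P2.missingLowerBoundAt_of_openInputOddAt W p hGZ hKo hWu hGZK hmod hnf hHL hMaz hPT hEP hA hX
      hsurj)
    (missingUpperBoundAt_of_classX11b_of_ram_of_not_dvd hGZ hKo hB hSk hGZK hmod hnf hHL hMaz
      integral_neronScaling_of_isGloballyMinimal_holds W p hX hram htam)

/-- **`BSD(E,p)` ⟹ THE OPEN INPUT (odd form), on the (ram) part of X11b at ANY ODD prime, given the
published control identity** — the sibling's `P2.openInputOnTreeAt_of_bsdp_of_ram` with `5 ≤ p`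
removed. The control identity is stated INLINE: verbatim the body of `P2ControlOnTreeAt W p`
(`BDPRouteRecord.lean`, Castella 2018 Thm. 2.3 read on the constructed `X_ac`, PUB shape) minus its
antecedent `5 ≤ p`. LABEL of `hC`: the SHAPE of Castella 2018 Thm. 2.3, whose standing "p ⩾ 5"
(§2.1, arXiv:1704.06608 p. 5) is read as "p odd" — its printed proof is JSW 2017 Thm. 3.3.1 (printed
for "p ≥ 3", arXiv:1512.06894 p. 6) + (calcul); in the tree its ≤ half is the theorem
`controlUpperOnTreeAt_datum_of_facts`, its ≥ half is route R1's atom (P11), OPEN; hypothesis only,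
nothing asserted. Proof: at each datum `Ш(E/K)` is finite (Kolyvagin at the non-torsion Heegner point),
STEP L holds by the rigidity theorem `indexLowerBoundAt_of_bsdp_of_heegnerData_of_odd` (`BSD(E,p)` ⟹
`ord_p #Ш(E)_an ≤ ord_p #Ш(E)` ⟹ STEP L via Gross–Zagier and Skinner 2016 Thm. C for the twist —
where (ram) is used; printed for `p ≥ 3`), and §1 converts STEP L into (IMC≥∘BDP)ᵗ at every prime.
A TIGHTNESS statement: nothing is claimed about `BSD(E,p)` or about the open input themselves.
[cite: Castella2018, Thm. 2.3 (arXiv:1704.06608 p. 5) (shape only; nothing asserted), Thm. 3.2 (p. 9), (1.1) (p. 2)]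
[cite: JetchevSkinnerWan2017, Thm. 3.3.1 (p. 11), §7.4.1 (pp. 30–31)] [cite: Skinner2016PacificMC, Thm. C (§1) and footnote 1]
[cite: Kolyvagin1990, Thm. A] [cite: Miller2011LMS, Def. 1.1] -/
theorem P2.openInputOnTreeOddAt_of_bsdp_of_ram
    (hGZ : ∀ (N : ℕ) [NeZero N] (W : WeierstrassCurve ℚ) (K : Type) [Field K] [NumberField K],
      gross_zagier N W K)
    (hKo : ∀ (N : ℕ) [NeZero N] (W : WeierstrassCurve ℚ) (K : Type) [Field K] [NumberField K],
      kolyvagin N W K)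
    (hSk : Skinner2016.thmC_padicValRat_bsd_rank_zero)
    (hGZK : rank_eq_analyticRank_of_analyticRank_le_one) (hmod : hasEntireLFunction_rat)
    -- the control IDENTITY at the route's data, odd form (PUB shape; ≥ half NOT a tree theorem)
    (hC : ∀ (N : ℕ) [NeZero N] (K : Type) [Field K] [NumberField K]
      (Dt : ModularParametrizationData W N) (H : HeegnerDatum N (NumberField.discr K)) (ι : K →+* ℂ)
      (P : (W.baseChange K).toAffine.Point),
      ClassX11b W p → Surj W p → W.conductorNorm ℤ = N → IsImaginaryQuadratic K →
      Odd (NumberField.discr K) → ¬ (p : ℤ) ∣ NumberField.discr K → ¬ p ∣ Units.torsionOrder K →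
      SatisfiesHeegnerHypothesis N K →
      (W.quadraticTwist (NumberField.discr K : ℚ)).entireLFunction 1 ≠ 0 →
      WeierstrassCurve.Affine.Point.map ι.toRatAlgHom P = heegnerPointComplex Dt H →
      ¬ (p : ℤ) ∣ Dt.c → ¬ IsOfFinAddOrder P →
      ∀ (κ : ZpExtension K p), κ.IsAnticyclotomic →
        ∀ (γ : Field.absoluteGaloisGroup K) [Fact (κ.IsTopGenerator γ)]
          (𝔭 : HeightOneSpectrum (𝓞 K)) (h𝔭 : ((p : ℕ) : 𝓞 K) ∈ 𝔭.asIdeal)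
          (he : 𝔭.asIdeal.ramificationIdx (𝓞 ℚ) = 1) (hf : 𝔭.asIdeal.inertiaDeg (𝓞 ℚ) = 1),
          ControlOnTreeAt p κ 𝔭 γ (embAt K p 𝔭 h𝔭 he hf) P)
    (hram : Ram W p) (hbsd : BSDp W p) : P2OpenInputOnTreeOddAt W p := by
  intro N _ K _ _ Dt H ι P hX hs hN hK hodd hpd hμ hHN hLt hP hc hPinf κ hκ γ _ 𝔭 h𝔭 he hf
  have hCTL := hC N K Dt H ι P hX hs hN hK hodd hpd hμ hHN hLt hP hc hPinf κ hκ γ 𝔭 h𝔭 he hf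
  haveI : Finite (W.baseChange K).sha :=
    finite_sha_baseChange_of_heegner W N K Dt H ι P (hGZ N W K) (hKo N W K) hmod hX.1 hK hHN hLt hP
  refine imcLowerWaldspurgerOnTreeAt_of_controlOnTreeAt_of_indexLowerBoundAt_prime hK hN hHN hCTL ?_
  -- STEP L at this datum from `BSD(E,p)` (rigidity, odd prime), at level `N = N_E`
  subst hN
  have hD0 : (NumberField.discr K : ℚ) ≠ 0 := by exact_mod_cast NumberField.discr_ne_zero K
  haveI hEt : (W.quadraticTwist (NumberField.discr K : ℚ)).IsElliptic :=
    W.isElliptic_quadraticTwist hD0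
  obtain ⟨Cd, hCd⟩ := hasGlobalMinimalModel_rat_holds (W.quadraticTwist (NumberField.discr K : ℚ))
  haveI := hCd
  exact indexLowerBoundAt_of_bsdp_of_heegnerData_of_odd W p K Dt H ι P (hGZ _ W K) (hKo _ W K) hSk
    hGZK hmod hX hram hK hodd hHN hP hc hμ hLt (Cd • W.quadraticTwist (NumberField.discr K : ℚ)) Cd
    rfl hbsd

/-- **THE OPEN INPUT (odd form) ⟺ `BSD(E,p)` ON THE LOCUS, ANY ODD PRIME** (`(E,p) ∈` X11b, a (ram)
prime, `p ∤ ∏_ℓ c_ℓ(E)`), given the twelve published facts of the route and the PUB-shaped control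
identity (odd form, inline, used ONLY in the direction ⟸; see `P2.openInputOnTreeOddAt_of_bsdp_of_ram`
for its label). (⟹) is `P2.bsdp_of_locus_endState_odd`; (⟸) is `P2.openInputOnTreeOddAt_of_bsdp_of_ram`.
Reading: at every odd prime route p2 asks of the literature, on the Locus, EXACTLY the worth of its
conclusion — the typed input is neither stronger nor weaker than `BSD(E,p)` modulo published shapes;
in particular it cannot fail at a pair where `BSD(E,p)` holds and the control identity holds.
CONDITIONAL bookkeeping; nothing booked; X11b stays CONSTRUCTION-SHAPED.
[cite: Castella2018, Thm. 2.3 (p. 5), Thm. 3.2 (p. 9)] [cite: Castella2018Erratum, (2.4) (p. 1)]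
[cite: JetchevSkinnerWan2017, §7.4.1–7.4.3 (pp. 30–31), Thm. 3.3.1] [cite: Skinner2016PacificMC, Thm. C (§1) and footnote 1]
[cite: McCallumLMS1991, §1 Theorem (Kolyvagin), p. 296] [cite: Wuthrich2014, Prop. 21 (p. 400)] [cite: Miller2011LMS, Def. 1.1] -/
theorem P2.openInputOnTreeOddAt_iff_bsdp_of_locus
    (hGZ : ∀ (N : ℕ) [NeZero N] (W : WeierstrassCurve ℚ) (K : Type) [Field K] [NumberField K],
      gross_zagier N W K)
    (hKo : ∀ (N : ℕ) [NeZero N] (W : WeierstrassCurve ℚ) (K : Type) [Field K] [NumberField K],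
      kolyvagin N W K)
    (hB : ∀ (N : ℕ) [NeZero N] (W : WeierstrassCurve ℚ) (K : Type) [Field K] [NumberField K],
      Kolyvagin1990_padicValNat_card_sha_le N W K)
    (hSk : Skinner2016.thmC_padicValRat_bsd_rank_zero) (hWu : sha_dvd_analyticSha)
    (hGZK : rank_eq_analyticRank_of_analyticRank_le_one) (hmod : hasEntireLFunction_rat)
    (hnf : exists_isNewformOf) (hHL : HoffsteinLuo1997_exists_twist_L_one_ne_zero)
    (hMaz : mazur_not_dvd_maninConstant_of_odd)
    (hPT : ∀ (K : Type) [Field K] [NumberField K], poitouTate_sum_localTatePairing_eq_zero K)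
    (hEP : ∀ (K : Type) [Field K] [NumberField K] (v : HeightOneSpectrum (𝓞 K)),
      localEulerPoincareCharacteristic (v.adicCompletion K))
    -- the control IDENTITY (odd form, PUB shape), used only in the direction `BSD ⟹ open input`
    (hC : ∀ (N : ℕ) [NeZero N] (K : Type) [Field K] [NumberField K]
      (Dt : ModularParametrizationData W N) (H : HeegnerDatum N (NumberField.discr K)) (ι : K →+* ℂ)
      (P : (W.baseChange K).toAffine.Point),
      ClassX11b W p → Surj W p → W.conductorNorm ℤ = N → IsImaginaryQuadratic K →
      Odd (NumberField.discr K) → ¬ (p : ℤ) ∣ NumberField.discr K → ¬ p ∣ Units.torsionOrder K →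
      SatisfiesHeegnerHypothesis N K →
      (W.quadraticTwist (NumberField.discr K : ℚ)).entireLFunction 1 ≠ 0 →
      WeierstrassCurve.Affine.Point.map ι.toRatAlgHom P = heegnerPointComplex Dt H →
      ¬ (p : ℤ) ∣ Dt.c → ¬ IsOfFinAddOrder P →
      ∀ (κ : ZpExtension K p), κ.IsAnticyclotomic →
        ∀ (γ : Field.absoluteGaloisGroup K) [Fact (κ.IsTopGenerator γ)]
          (𝔭 : HeightOneSpectrum (𝓞 K)) (h𝔭 : ((p : ℕ) : 𝓞 K) ∈ 𝔭.asIdeal)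
          (he : 𝔭.asIdeal.ramificationIdx (𝓞 ℚ) = 1) (hf : 𝔭.asIdeal.inertiaDeg (𝓞 ℚ) = 1),
          ControlOnTreeAt p κ 𝔭 γ (embAt K p 𝔭 h𝔭 he hf) P)
    -- the pair: on the Locus
    (hX : ClassX11b W p) (hram : Ram W p) (htam : ¬ p ∣ W.tamagawaProduct) :
    P2OpenInputOnTreeOddAt W p ↔ BSDp W p :=
  ⟨fun hA ↦ P2.bsdp_of_locus_endState_odd W p hGZ hKo hB hSk hWu hGZK hmod hnf hHL hMaz hPT hEP hA hX
      hram htam,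
    P2.openInputOnTreeOddAt_of_bsdp_of_ram W p hGZ hKo hSk hGZK hmod hC hram⟩

end Pair

/-! ### §3. The `p = 3` rows (team N8/O2): atom A1 and its semistable part -/

section Three

variable (W : WeierstrassCurve ℚ) [W.IsElliptic] [W.IsGloballyMinimal]

/-- **X11b@3, atom A1 (the Locus at `3`: (ram) ∧ `3 ∤ ∏_ℓ c_ℓ(E)`; census3: 248 943 class-pairs
`N < 5·10⁵`) — THE open input at `(E,3)` ⟺ `BSD(E,3)`**, given the twelve published facts and the
PUB-shaped control identity at `3` (odd form, inline; label as in `P2.openInputOnTreeOddAt_of_bsdp_of_ram`;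
used only in the direction ⟸). The `p = 3` row of `P2.openInputOnTreeOddAt_iff_bsdp_of_locus`. NOTHING
in print or announced supplies the open input at `3` (Howard 2007 "p ∤ 6N"; Castella 2018/2020,
Skinner–Zhang 2014, Fouquet–Wan 2021 "p ≥ 5"); X11b@3 stays OPEN (RESIDUAL-MAP §I O2). CONDITIONAL
bookkeeping; nothing booked. [cite: Castella2018, Thm. 2.3 (p. 5), Thm. 3.2 (p. 9)]
[cite: JetchevSkinnerWan2017, Thm. 3.3.1 (p. 11), §7.4.1–7.4.3 (pp. 30–31)] [cite: Skinner2016PacificMC, Thm. C (§1) and footnote 1]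
[cite: Wuthrich2014, Prop. 21 (p. 400)] [cite: Miller2011LMS, Def. 1.1] -/
theorem P2.openInputOnTreeOddAt_three_iff_bsdp_of_locus [Fact (Nat.Prime 3)]
    (hGZ : ∀ (N : ℕ) [NeZero N] (W : WeierstrassCurve ℚ) (K : Type) [Field K] [NumberField K],
      gross_zagier N W K)
    (hKo : ∀ (N : ℕ) [NeZero N] (W : WeierstrassCurve ℚ) (K : Type) [Field K] [NumberField K],
      kolyvagin N W K)
    (hB : ∀ (N : ℕ) [NeZero N] (W : WeierstrassCurve ℚ) (K : Type) [Field K] [NumberField K],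
      Kolyvagin1990_padicValNat_card_sha_le N W K)
    (hSk : Skinner2016.thmC_padicValRat_bsd_rank_zero) (hWu : sha_dvd_analyticSha)
    (hGZK : rank_eq_analyticRank_of_analyticRank_le_one) (hmod : hasEntireLFunction_rat)
    (hnf : exists_isNewformOf) (hHL : HoffsteinLuo1997_exists_twist_L_one_ne_zero)
    (hMaz : mazur_not_dvd_maninConstant_of_odd)
    (hPT : ∀ (K : Type) [Field K] [NumberField K], poitouTate_sum_localTatePairing_eq_zero K)
    (hEP : ∀ (K : Type) [Field K] [NumberField K] (v : HeightOneSpectrum (𝓞 K)),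
      localEulerPoincareCharacteristic (v.adicCompletion K))
    (hC : ∀ (N : ℕ) [NeZero N] (K : Type) [Field K] [NumberField K]
      (Dt : ModularParametrizationData W N) (H : HeegnerDatum N (NumberField.discr K)) (ι : K →+* ℂ)
      (P : (W.baseChange K).toAffine.Point),
      ClassX11b W 3 → Surj W 3 → W.conductorNorm ℤ = N → IsImaginaryQuadratic K →
      Odd (NumberField.discr K) → ¬ (3 : ℤ) ∣ NumberField.discr K → ¬ 3 ∣ Units.torsionOrder K →
      SatisfiesHeegnerHypothesis N K →
      (W.quadraticTwist (NumberField.discr K : ℚ)).entireLFunction 1 ≠ 0 →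
      WeierstrassCurve.Affine.Point.map ι.toRatAlgHom P = heegnerPointComplex Dt H →
      ¬ (3 : ℤ) ∣ Dt.c → ¬ IsOfFinAddOrder P →
      ∀ (κ : ZpExtension K 3), κ.IsAnticyclotomic →
        ∀ (γ : Field.absoluteGaloisGroup K) [Fact (κ.IsTopGenerator γ)]
          (𝔭 : HeightOneSpectrum (𝓞 K)) (h𝔭 : ((3 : ℕ) : 𝓞 K) ∈ 𝔭.asIdeal)
          (he : 𝔭.asIdeal.ramificationIdx (𝓞 ℚ) = 1) (hf : 𝔭.asIdeal.inertiaDeg (𝓞 ℚ) = 1),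
          ControlOnTreeAt 3 κ 𝔭 γ (embAt K 3 𝔭 h𝔭 he hf) P)
    (hX : ClassX11b W 3) (hram : Ram W 3) (htam : ¬ 3 ∣ W.tamagawaProduct) :
    P2OpenInputOnTreeOddAt W 3 ↔ BSDp W 3 :=
  P2.openInputOnTreeOddAt_iff_bsdp_of_locus W 3 hGZ hKo hB hSk hWu hGZK hmod hnf hHL hMaz hPT hEP hC
    hX hram htam

/-- **X11b@3 on a SEMISTABLE curve with `3 ∤ ∏_ℓ c_ℓ(E)` (census3: 100 315 class-pairs `N < 5·10⁵`,
atom A1 ∩ semistable) — THE open input at `(E,3)` ⟺ `BSD(E,3)`**, given the published facts (the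
twelve, plus Diamond's refined level-lowering `hLL` for the automatic (ram) witness —
`ram_of_semistable_of_irr_of_le_seven`, rmap-3 g4) and the PUB-shaped control identity at `3` (odd
form, inline; used only in ⟸). On this sub-population NOTHING but THE open input is typed on the
⟹ side (`bsdp_of_semistable_classX11b_of_openInput_of_not_dvd_of_le_seven`). CONDITIONAL bookkeeping;
nothing booked; X11b@3 stays OPEN. [cite: Castella2018, Thm. 2.3 (p. 5), Thm. 3.2 (p. 9)]
[cite: JetchevSkinnerWan2017, Thm. 3.3.1 (p. 11), §7.4.1–7.4.3 (pp. 30–31)] [cite: Skinner2016PacificMC, Thm. C (§1) and footnote 1]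
[cite: Wuthrich2014, Prop. 21 (p. 400)] [cite: Miller2011LMS, Def. 1.1] -/
theorem P2.openInputOnTreeOddAt_three_iff_bsdp_of_semistable_of_not_dvd [Fact (Nat.Prime 3)]
    (hGZ : ∀ (N : ℕ) [NeZero N] (W : WeierstrassCurve ℚ) (K : Type) [Field K] [NumberField K],
      gross_zagier N W K)
    (hKo : ∀ (N : ℕ) [NeZero N] (W : WeierstrassCurve ℚ) (K : Type) [Field K] [NumberField K],
      kolyvagin N W K)
    (hB : ∀ (N : ℕ) [NeZero N] (W : WeierstrassCurve ℚ) (K : Type) [Field K] [NumberField K],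
      Kolyvagin1990_padicValNat_card_sha_le N W K)
    (hSk : Skinner2016.thmC_padicValRat_bsd_rank_zero) (hWu : sha_dvd_analyticSha)
    (hGZK : rank_eq_analyticRank_of_analyticRank_le_one) (hmod : hasEntireLFunction_rat)
    (hnf : exists_isNewformOf) (hHL : HoffsteinLuo1997_exists_twist_L_one_ne_zero)
    (hMaz : mazur_not_dvd_maninConstant_of_odd)
    (hPT : ∀ (K : Type) [Field K] [NumberField K], poitouTate_sum_localTatePairing_eq_zero K)
    (hEP : ∀ (K : Type) [Field K] [NumberField K] (v : HeightOneSpectrum (𝓞 K)),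
      localEulerPoincareCharacteristic (v.adicCompletion K))
    (hLL : Literature.NumberTheory.Automorphic.diamond1995_refinedSerre)
    (hC : ∀ (N : ℕ) [NeZero N] (K : Type) [Field K] [NumberField K]
      (Dt : ModularParametrizationData W N) (H : HeegnerDatum N (NumberField.discr K)) (ι : K →+* ℂ)
      (P : (W.baseChange K).toAffine.Point),
      ClassX11b W 3 → Surj W 3 → W.conductorNorm ℤ = N → IsImaginaryQuadratic K →
      Odd (NumberField.discr K) → ¬ (3 : ℤ) ∣ NumberField.discr K → ¬ 3 ∣ Units.torsionOrder K →
      SatisfiesHeegnerHypothesis N K →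
      (W.quadraticTwist (NumberField.discr K : ℚ)).entireLFunction 1 ≠ 0 →
      WeierstrassCurve.Affine.Point.map ι.toRatAlgHom P = heegnerPointComplex Dt H →
      ¬ (3 : ℤ) ∣ Dt.c → ¬ IsOfFinAddOrder P →
      ∀ (κ : ZpExtension K 3), κ.IsAnticyclotomic →
        ∀ (γ : Field.absoluteGaloisGroup K) [Fact (κ.IsTopGenerator γ)]
          (𝔭 : HeightOneSpectrum (𝓞 K)) (h𝔭 : ((3 : ℕ) : 𝓞 K) ∈ 𝔭.asIdeal)
          (he : 𝔭.asIdeal.ramificationIdx (𝓞 ℚ) = 1) (hf : 𝔭.asIdeal.inertiaDeg (𝓞 ℚ) = 1),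
          ControlOnTreeAt 3 κ 𝔭 γ (embAt K 3 𝔭 h𝔭 he hf) P)
    (hsst : Semistable W) (hX : ClassX11b W 3) (htam : ¬ 3 ∣ W.tamagawaProduct) :
    P2OpenInputOnTreeOddAt W 3 ↔ BSDp W 3 :=
  P2.openInputOnTreeOddAt_iff_bsdp_of_locus W 3 hGZ hKo hB hSk hWu hGZK hmod hnf hHL hMaz hPT hEP hC
    hX (ram_of_semistable_of_irr_of_le_seven hnf hLL W 3 hX.2.1 (by norm_num) hsst hX.2.2.2) htam

end Three

end Summit.BirchSwinnertonDyer.Rank1Residual.X11b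

end
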